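import Mathlib
import Summits.Ventures.PercRepro2.TypedLocusBridge

/-!
# The block-transfer rule for typed counts, with the pointwise alternatives (blind cell PercRepro2,
mine-2 g37, 2026-08-28; `proofs/MINE2-FIBRE.md` §2b, row M2-77)

`typedCount_eq_zero_of_blocks'` weakens the block hypothesis `HW` of `typedCount_eq_zero_of_blocks`
to what the census tests on every PD spectator: a block of one of the two kinds, OR `b` attached to a
root by the forced-open edges (then `σ_b` is the same in both copies of every pair and the piece
vanishes pointwise), OR `o` attached to a root (then, with `a₃` attached by `H3`, `F = σ_o − σ₃ u_o`
is the same in both copies).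

Own code; standard axioms.
-/

namespace Summit.Ventures.PercRepro2

open UnionCluster

namespace CovForm

namespace LocusBridge

open OneTyped TypedA3 BlockTransfer

section Pointwise

open Classical

variable {V : Type*} {E : Type*} [Fintype E] [DecidableEq E] {R : Type*} [Field R]
  [LinearOrder R] [IsStrictOrderedRing R]
variable (ends : E → Sym2 V) (o a₁ a₂ a₃ b : V)

omit [Fintype E] [DecidableEq E] [LinearOrder R] [IsStrictOrderedRing R] in
/-- Two copies with `Q` in which a vertex `v` is joined to the same root have the same `σ_v`. -/
lemma sigma_eq_of_attached (v : V) (y w : Config E) (hy : ¬ Conn ends y a₂ a₁)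
    (hw : ¬ Conn ends w a₂ a₁) {r : V} (hr : r = a₁ ∨ r = a₂) (h1 : Conn ends y v r)
    (h2 : Conn ends w v r) : (sigma ends a₁ a₂ v y : R) = sigma ends a₁ a₂ v w := by
  unfold sigma iL iH
  simp only [Set.indicator_apply, mem_connEvent, Pi.one_apply]
  rcases hr with hr | hr
  · rw [hr] at h1 h2
    have hy1 : Conn ends y a₁ v := conn_symm h1
    have hw1 : Conn ends w a₁ v := conn_symm h2
    have hy2 : ¬ Conn ends y a₂ v := fun h => hy (conn_trans h (conn_symm hy1))
    have hw2 : ¬ Conn ends w a₂ v := fun h => hw (conn_trans h (conn_symm hw1))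
    rw [if_pos hy1, if_pos hw1, if_neg hy2, if_neg hw2]
  · rw [hr] at h1 h2
    have hy2 : Conn ends y a₂ v := conn_symm h1
    have hw2 : Conn ends w a₂ v := conn_symm h2
    have hy1 : ¬ Conn ends y a₁ v := fun h => hy (conn_trans hy2 (conn_symm h))
    have hw1 : ¬ Conn ends w a₁ v := fun h => hw (conn_trans hw2 (conn_symm h))
    rw [if_neg hy1, if_neg hw1, if_pos hy2, if_pos hw2]

omit [Fintype E] [DecidableEq E] [LinearOrder R] [IsStrictOrderedRing R] in
/-- Two copies with `Q` in which a vertex `v` is joined to the same root have the same `1_{v ∈ U}`. -/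
lemma inU_eq_of_attached (v : V) (y w : Config E) (hy : ¬ Conn ends y a₂ a₁)
    (hw : ¬ Conn ends w a₂ a₁) {r : V} (hr : r = a₁ ∨ r = a₂) (h1 : Conn ends y v r)
    (h2 : Conn ends w v r) : (inU ends a₁ a₂ v y : R) = inU ends a₁ a₂ v w := by
  unfold inU iL iH
  simp only [Set.indicator_apply, mem_connEvent, Pi.one_apply]
  rcases hr with hr | hr
  · rw [hr] at h1 h2
    have hy1 : Conn ends y a₁ v := conn_symm h1
    have hw1 : Conn ends w a₁ v := conn_symm h2
    have hy2 : ¬ Conn ends y a₂ v := fun h => hy (conn_trans h (conn_symm hy1))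
    have hw2 : ¬ Conn ends w a₂ v := fun h => hw (conn_trans h (conn_symm hw1))
    rw [if_pos hy1, if_pos hw1, if_neg hy2, if_neg hw2]
  · rw [hr] at h1 h2
    have hy2 : Conn ends y a₂ v := conn_symm h1
    have hw2 : Conn ends w a₂ v := conn_symm h2
    have hy1 : ¬ Conn ends y a₁ v := fun h => hy (conn_trans hy2 (conn_symm h))
    have hw1 : ¬ Conn ends w a₁ v := fun h => hw (conn_trans hw2 (conn_symm h))
    rw [if_neg hy1, if_neg hw1, if_pos hy2, if_pos hw2]

omit [LinearOrder R] [IsStrictOrderedRing R] in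
/-- If `b` is attached to a root by the forced-open edges of a fibre, the covariance of `F` against
`σ_b` has complementary-pair count `0` (the term vanishes pointwise). -/
lemma pinnedCount_covW_eq_zero_of_b_attached (F : Finset E) (z : Config E) (τ : E → ℕ)
    (x : Config E) {r : V} (hr : r = a₁ ∨ r = a₂) (hb : Conn ends (specPin F z τ x) b r) :
    pinnedCount (specFree F τ x) (specPin F z τ x)
      (covW ends a₁ a₂ (Fc ends o a₁ a₂ a₃) (sigma ends a₁ a₂ b) : Config E → Config E → R) = 0 := by
  unfold pinnedCount
  refine Finset.sum_eq_zero fun y _ => ?_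
  split_ifs with hy
  · obtain ⟨hle1, hle2⟩ := specPin_le_pair F z τ x y hy
    unfold covW
    by_cases hQy : Conn ends y a₂ a₁
    · rw [iQ_eq_ite', if_pos hQy]; ring
    by_cases hQw : Conn ends (flipOn (specFree F τ x) y) a₂ a₁
    · rw [iQ_eq_ite' (flipOn (specFree F τ x) y), if_pos hQw]; ring
    rw [sigma_eq_of_attached ends a₁ a₂ b y (flipOn (specFree F τ x) y) hQy hQw hr
      (conn_mono hle1 hb) (conn_mono hle2 hb)]
    ring
  · rfl

omit [LinearOrder R] [IsStrictOrderedRing R] in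
/-- If `o` and `a₃` are attached to roots by the forced-open edges of a fibre, the covariance of
`F = σ_o − σ₃ 1_{o∈U}` against `σ_b` has complementary-pair count `0`. -/
lemma pinnedCount_covW_eq_zero_of_o_attached (F : Finset E) (z : Config E) (τ : E → ℕ)
    (x : Config E) {r r' : V} (hr : r = a₁ ∨ r = a₂) (hr' : r' = a₁ ∨ r' = a₂)
    (ho : Conn ends (specPin F z τ x) o r) (h3 : Conn ends (specPin F z τ x) a₃ r') :
    pinnedCount (specFree F τ x) (specPin F z τ x)
      (covW ends a₁ a₂ (Fc ends o a₁ a₂ a₃) (sigma ends a₁ a₂ b) : Config E → Config E → R) = 0 := by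
  unfold pinnedCount
  refine Finset.sum_eq_zero fun y _ => ?_
  split_ifs with hy
  · obtain ⟨hle1, hle2⟩ := specPin_le_pair F z τ x y hy
    unfold covW Fc
    by_cases hQy : Conn ends y a₂ a₁
    · rw [iQ_eq_ite', if_pos hQy]; ring
    by_cases hQw : Conn ends (flipOn (specFree F τ x) y) a₂ a₁
    · rw [iQ_eq_ite' (flipOn (specFree F τ x) y), if_pos hQw]; ring
    rw [sigma_eq_of_attached ends a₁ a₂ o y (flipOn (specFree F τ x) y) hQy hQw hr
      (conn_mono hle1 ho) (conn_mono hle2 ho),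
      sigma_eq_of_attached ends a₁ a₂ a₃ y (flipOn (specFree F τ x) y) hQy hQw hr'
      (conn_mono hle1 h3) (conn_mono hle2 h3),
      inU_eq_of_attached ends a₁ a₂ o y (flipOn (specFree F τ x) y) hQy hQw hr
      (conn_mono hle1 ho) (conn_mono hle2 ho)]
    ring
  · rfl

/-- **The block-transfer rule for typed counts, with the pointwise alternatives**: on every PD
spectator's fibre, a block of one of the two kinds, or `b` attached to a root, or `o` attached to a
root (with `a₃` attached by `H3`). -/
theorem typedCount_eq_zero_of_blocks' (F : Finset E) (z : Config E) (τ : E → ℕ)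
    (hτ : ∀ e ∈ F, τ e = 1 ∨ τ e = 2)
    (H3 : ∀ x : Config E, (∀ e, e ∉ F → x e = z e) → ¬ Conn ends x a₂ a₁ → ¬ Conn ends x a₁ a₃ →
      ¬ Conn ends x a₂ a₃ → (Conn ends (specPin F z τ x) a₃ a₁ ∨ Conn ends (specPin F z τ x) a₃ a₂))
    (HW : ∀ x : Config E, (∀ e, e ∉ F → x e = z e) → ¬ Conn ends x a₂ a₁ → ¬ Conn ends x a₁ a₃ →
      ¬ Conn ends x a₂ a₃ →
      (∃ W : Finset V, BlockData ends a₁ a₂ W (specFree F τ x) (specPin F z τ x) ∧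
        ((b ∈ W ∧ o ∉ W ∧ a₃ ∉ W) ∨ (o ∈ W ∧ a₃ ∈ W ∧ b ∉ W))) ∨
      (Conn ends (specPin F z τ x) b a₁ ∨ Conn ends (specPin F z τ x) b a₂) ∨
      (Conn ends (specPin F z τ x) o a₁ ∨ Conn ends (specPin F z τ x) o a₂)) :
    typedCount F z τ (K3 ends o a₁ a₂ a₃ b : Config E → Config E → Config E → R) = 0 := by
  have h2 := two_mul_typedCount_eq_pieces (R := R) ends o a₁ a₂ a₃ b F z τ hτ
  rw [typedCount_eq_sum_spec F z τ hτ (Dc ends o a₁ a₂ a₃ b : Config E → Config E → Config E → R)]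
    at h2
  have hzero : ∀ x : Config E, (∀ e, e ∉ F → x e = z e) →
      pinnedCount (specFree F τ x) (specPin F z τ x)
        (Dc ends o a₁ a₂ a₃ b x : Config E → Config E → R) = 0 := by
    intro x hx
    have hcongr : pinnedCount (specFree F τ x) (specPin F z τ x)
        (Dc ends o a₁ a₂ a₃ b x : Config E → Config E → R) =
        pinnedCount (specFree F τ x) (specPin F z τ x) (fun y w =>
          ((qB (st ends o a₁ a₂ a₃ b x) * pdB (st ends o a₁ a₂ a₃ b x) : ℤ) : R) *
            covW ends a₁ a₂ (Fc ends o a₁ a₂ a₃) (sigma ends a₁ a₂ b) y w) := by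
      unfold pinnedCount
      refine Finset.sum_congr rfl fun y _ => ?_
      split_ifs with hy
      · exact Dc_eq_on_fibre ends o a₁ a₂ a₃ b F z τ hτ H3 x hx y hy
      · rfl
    rw [hcongr, pinnedCount_const_mul]
    by_cases hpd : pdB (st ends o a₁ a₂ a₃ b x) = 0
    · rw [hpd]; simp
    · obtain ⟨hQx, h13, h23⟩ := pd_of_pdB_ne_zero ends o a₁ a₂ a₃ b x hpd
      have hzero' : pinnedCount (specFree F τ x) (specPin F z τ x)
          (covW ends a₁ a₂ (Fc ends o a₁ a₂ a₃) (sigma ends a₁ a₂ b) : Config E → Config E → R) = 0 := by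
        rcases HW x hx hQx h13 h23 with ⟨W, hd, hW⟩ | hb | ho
        · rcases hW with ⟨hb, ho, h3⟩ | ⟨ho, h3, hb⟩
          · have h0 := pinnedCount_blockTransfer_b (R := R) hd ho h3 hb
            rw [← h0]
            exact pinnedCount_congr _ _ _ _ (fun y w => rfl)
          · have h0 := pinnedCount_blockTransfer_o (R := R) hd ho h3 hb
            rw [← h0]
            exact pinnedCount_congr _ _ _ _ (fun y w => by unfold covW Fc; ring)
        · rcases hb with hb | hb
          · exact pinnedCount_covW_eq_zero_of_b_attached ends o a₁ a₂ a₃ b F z τ x (Or.inl rfl) hb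
          · exact pinnedCount_covW_eq_zero_of_b_attached ends o a₁ a₂ a₃ b F z τ x (Or.inr rfl) hb
        · rcases H3 x hx hQx h13 h23 with h3 | h3 <;> rcases ho with ho | ho
          · exact pinnedCount_covW_eq_zero_of_o_attached ends o a₁ a₂ a₃ b F z τ x (Or.inl rfl)
              (Or.inl rfl) ho h3
          · exact pinnedCount_covW_eq_zero_of_o_attached ends o a₁ a₂ a₃ b F z τ x (Or.inr rfl)
              (Or.inl rfl) ho h3
          · exact pinnedCount_covW_eq_zero_of_o_attached ends o a₁ a₂ a₃ b F z τ x (Or.inl rfl)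
              (Or.inr rfl) ho h3
          · exact pinnedCount_covW_eq_zero_of_o_attached ends o a₁ a₂ a₃ b F z τ x (Or.inr rfl)
              (Or.inr rfl) ho h3
      rw [hzero']; ring
  have hsum : (∑ x : Config E, if (∀ e, e ∉ F → x e = z e) then
      pinnedCount (specFree F τ x) (specPin F z τ x)
        (Dc ends o a₁ a₂ a₃ b x : Config E → Config E → R) else 0) = (0 : R) := by
    refine Finset.sum_eq_zero fun x _ => ?_
    split_ifs with hx
    · exact hzero x hx
    · rfl
  rw [hsum] at h2
  have h2' : (2 : R) ≠ 0 := by norm_num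
  exact (mul_eq_zero.mp h2).resolve_left h2'

end Pointwise

end LocusBridge

end CovForm

end Summit.Ventures.PercRepro2
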